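import Summits.Ventures.LatticeQCDFlow.Exactness.ReversibleMixtureHarmonicMean
import Summits.Ventures.LatticeQCDFlow.Exactness.Phi4FlowHMCHybrid
import HarnessLib

/-!
# The flow + HMC hybrid on lattice φ⁴ is never worse than the HARMONIC MEAN of its two arms: `τ_M + ½ ≤ 1/(a/(τ_flow + ½) + (1 − a)/(τ_HMC + ½))`; any finite hybrid of flows and trajectories likewise

HONEST FRAMING: exact (Metropolis-corrected) sampling algorithms for lattice gauge theory;
figures of merit are autocorrelation/cost numbers at stated couplings and volumes; no
continuum-physics claim.  (SCALAR calibration rung S0-A: not a gauge result.)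

Venture `LatticeQCDFlow` (cell pub-lqcd), topic `Exactness`; FANOUT row 2 (`s0-phi4`).  NEW WORK of the
cell: the lattice instances of `ReversibleMixtureHarmonicMean` (the `N`-component harmonic-mean bound
for random mixtures of exact reversible updates).  The tree's `Phi4FlowHMCHybrid` proved, for the
hybrid `M = a·FLOW + (1 − a)·HMC` on the bounded observables `BddObs` of lattice φ⁴, the two weight
bounds `τ_M + ½ ≤ (τ_flow + ½)/a` and `≤ (τ_HMC + ½)/(1 − a)`.  Their common sharpening:

  **`τ_M(g) + ½ ≤ 1/(a/(τ_flow(g) + ½) + (1 − a)/(τ_HMC(g) + ½))`**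

(the weighted harmonic mean, which is `≤` both weight bounds and `≤` the arithmetic mean), and the
`N`-component form for ANY finite family of row 2's flow samplers (several trained flows `q̃ᵢ`) and
HMC updates (several step sizes / trajectory lengths) mixed with positive weights: every bounded
observable is served, in `τ + ½`, at least as well as the harmonic mean over all arms.  Every `λ > 0`,
real `J`.  Nothing is cited as a fact.

## What is proved

* **`phi4Hybrid_tauInt_add_half_le_harmonicMean`** — flow + HMC, two arms;
* **`phi4FlowFamily_tauInt_add_half_le_harmonicMean`** — a finite family of flows `q̃ᵢ` mixed with
  weights `αᵢ` as KERNELS (random alternation of exact flow samplers; compare the PROPOSAL mixture of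
  `FlowSamplerMixtureHarmonicMean`, which is Peskun-better).

NOT CLAIMED: cost accounting (a flow proposal and a trajectory have different prices — the bound is
per update); that the hybrid beats both arms (it can); any number for any run or network.
-/

namespace Summit.Ventures.LatticeQCDFlow.Exactness

open Real MeasureTheory Filter Finset Set Topology
open Summit.Ventures.LatticeQCDFlow.Scoring

section Lattice

variable {n : ℕ}

/-- The centred version of a bounded observable is bounded. -/
theorem bddObs_sub_gibbsExpect (J : Fin (n + 1) → Fin (n + 1) → ℝ) (lam : ℝ)
    {g : (Fin (n + 1) → ℝ) → ℝ} (hg : BddObs g) : BddObs (fun ψ => g ψ - gibbsExpect J lam g) := by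
  have h := bddObs_add_mul hg (bddObs_const 1) (-gibbsExpect J lam g)
  have e : (fun φ => g φ + -gibbsExpect J lam g * (1 : ℝ)) = fun ψ => g ψ - gibbsExpect J lam g :=
    funext fun φ => by ring
  rw [e] at h
  exact h

/-- **THE FLOW + HMC HYBRID IS NEVER WORSE THAN THE HARMONIC MEAN OF ITS ARMS.**  `λ > 0`, real `J`,
positive measurable model density `q̃` (`∫ q̃ = 1`), any `δ`, `N`; `M f = a·(flow update f) + (1 − a)·(HMC
update f)` with `0 < a < 1`; `g ∈ BddObs`, `Var g > 0`, normalised series of `g − ⟨g⟩` summable under the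
flow sampler, under HMC and under `M`.  Then
`τ_M(g) + ½ ≤ 1/(a/(τ_flow(g) + ½) + (1 − a)/(τ_HMC(g) + ½))`. -/
theorem phi4Hybrid_tauInt_add_half_le_harmonicMean {lam : ℝ} (hlam : 0 < lam)
    (J : Fin (n + 1) → Fin (n + 1) → ℝ)
    {q : (Fin (n + 1) → ℝ) → ℝ} (hq0 : ∀ φ, 0 < q φ) (hqm : Measurable q) (hqi : Integrable q)
    (hq1 : ∫ φ, q φ = 1) (δ : ℝ) (N : ℕ) {a : ℝ} (ha0 : 0 < a) (ha1 : a < 1)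
    {M : ((Fin (n + 1) → ℝ) → ℝ) → ((Fin (n + 1) → ℝ) → ℝ)}
    (hM : ∀ f φ, M f φ = a * imhOpPhi4 J lam q f φ + (1 - a) * hmcOpPhi4 J lam δ N f φ)
    {g : (Fin (n + 1) → ℝ) → ℝ} (hg : BddObs g)
    (hP : 0 < ∫ φ, (g φ - gibbsExpect J lam g) ^ 2 * gibbsWeight J lam φ)
    (hsF : Summable fun k => (∫ φ, (g φ - gibbsExpect J lam g)
        * ((imhOpPhi4 J lam q)^[k + 1] (fun ψ => g ψ - gibbsExpect J lam g)) φ * gibbsWeight J lam φ)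
        / ∫ φ, (g φ - gibbsExpect J lam g) ^ 2 * gibbsWeight J lam φ)
    (hsH : Summable fun k => (∫ φ, (g φ - gibbsExpect J lam g)
        * ((hmcOpPhi4 J lam δ N)^[k + 1] (fun ψ => g ψ - gibbsExpect J lam g)) φ * gibbsWeight J lam φ)
        / ∫ φ, (g φ - gibbsExpect J lam g) ^ 2 * gibbsWeight J lam φ)
    (hsM : Summable fun k => (∫ φ, (g φ - gibbsExpect J lam g)
        * (M^[k + 1] (fun ψ => g ψ - gibbsExpect J lam g)) φ * gibbsWeight J lam φ)
        / ∫ φ, (g φ - gibbsExpect J lam g) ^ 2 * gibbsWeight J lam φ) :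
    tauInt (fun k => (∫ φ, (g φ - gibbsExpect J lam g)
          * (M^[k] (fun ψ => g ψ - gibbsExpect J lam g)) φ * gibbsWeight J lam φ)
          / ∫ φ, (g φ - gibbsExpect J lam g) ^ 2 * gibbsWeight J lam φ) + 1 / 2
      ≤ 1 / (a / (tauInt (fun k => (∫ φ, (g φ - gibbsExpect J lam g)
              * ((imhOpPhi4 J lam q)^[k] (fun ψ => g ψ - gibbsExpect J lam g)) φ * gibbsWeight J lam φ)
              / ∫ φ, (g φ - gibbsExpect J lam g) ^ 2 * gibbsWeight J lam φ) + 1 / 2)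
          + (1 - a) / (tauInt (fun k => (∫ φ, (g φ - gibbsExpect J lam g)
              * ((hmcOpPhi4 J lam δ N)^[k] (fun ψ => g ψ - gibbsExpect J lam g)) φ * gibbsWeight J lam φ)
              / ∫ φ, (g φ - gibbsExpect J lam g) ^ 2 * gibbsWeight J lam φ) + 1 / 2)) := by
  have hco := latticePhi4Action_coercive hlam J
  obtain ⟨hS₁, hL₁, hY₁, hC₁⟩ := imhOpPhi4_revOp_bddObs hlam J hq0 hqm hqi hq1
  obtain ⟨hS₂, hL₂, hY₂, hC₂⟩ := hmcOpPhi4_revOp_bddObs hlam J δ N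
  have hgc := bddObs_sub_gibbsExpect J lam hg
  -- the hybrid as a `Fin 2`-indexed mixture
  set K : Fin 2 → ((Fin (n + 1) → ℝ) → ℝ) → ((Fin (n + 1) → ℝ) → ℝ) :=
    ![imhOpPhi4 J lam q, hmcOpPhi4 J lam δ N] with hK
  set α : Fin 2 → ℝ := ![a, 1 - a] with hα
  have hM' : ∀ f φ, M f φ = ∑ i, α i * K i f φ := fun f φ => by
    rw [hM]; simp [hK, hα, Fin.sum_univ_two]
  have h := RevOp.tauInt_mixN_add_half_le_harmonicMean (μ := volume) (A := BddObs) (K := K) (M := M)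
    (α := α) (w := gibbsWeight J lam) (fun φ => (gibbsWeight_pos J lam φ).le)
    (fun f h hf hh => bddObs_integrable_mul_mul_gibbsWeight one_pos hco hf hh)
    (fun f h c hf hh => bddObs_add_mul hf hh c)
    (fun i => by fin_cases i <;> simpa [hK] using (by first | exact hS₁ | exact hS₂))
    (fun i => by fin_cases i <;> simpa [hK] using (by first | exact hL₁ | exact hL₂))
    (fun i => by fin_cases i <;> simpa [hK] using (by first | exact hY₁ | exact hY₂))
    (fun i => by fin_cases i <;> simpa [hK] using (by first | exact hC₁ | exact hC₂))
    hM' (fun i => by fin_cases i <;> simp [hα] <;> linarith) (by simp [hα, Fin.sum_univ_two]) hgc hP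
    (S := Finset.univ) Finset.univ_nonempty
    (fun i _ => by fin_cases i <;> simpa [hK] using (by first | exact hsF | exact hsH)) hsM
  simpa [hK, hα, Fin.sum_univ_two] using h

/-- **A RANDOM ALTERNATION OF SEVERAL EXACT FLOW SAMPLERS IS NEVER WORSE THAN THE HARMONIC MEAN OF
THEIR `τ_int`.**  Flows `q̃ᵢ > 0` normalised, weights `αᵢ > 0`, `Σ αᵢ = 1`, `M f = Σ αᵢ (imhOpPhi4 J λ q̃ᵢ f)`;
`g ∈ BddObs`, `Var g > 0`, series of `g − ⟨g⟩` summable under each flow sampler and under `M`. -/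
theorem phi4FlowFamily_tauInt_add_half_le_harmonicMean {lam : ℝ} (hlam : 0 < lam)
    (J : Fin (n + 1) → Fin (n + 1) → ℝ) {ι : Type*} [Fintype ι] [Nonempty ι]
    {q : ι → (Fin (n + 1) → ℝ) → ℝ} (hq0 : ∀ i φ, 0 < q i φ) (hqm : ∀ i, Measurable (q i))
    (hqi : ∀ i, Integrable (q i)) (hq1 : ∀ i, ∫ φ, q i φ = 1) {α : ι → ℝ} (hα : ∀ i, 0 < α i)
    (hα1 : ∑ i, α i = 1) {M : ((Fin (n + 1) → ℝ) → ℝ) → ((Fin (n + 1) → ℝ) → ℝ)}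
    (hM : ∀ f φ, M f φ = ∑ i, α i * imhOpPhi4 J lam (q i) f φ)
    {g : (Fin (n + 1) → ℝ) → ℝ} (hg : BddObs g)
    (hP : 0 < ∫ φ, (g φ - gibbsExpect J lam g) ^ 2 * gibbsWeight J lam φ)
    (hs : ∀ i, Summable fun k => (∫ φ, (g φ - gibbsExpect J lam g)
        * ((imhOpPhi4 J lam (q i))^[k + 1] (fun ψ => g ψ - gibbsExpect J lam g)) φ * gibbsWeight J lam φ)
        / ∫ φ, (g φ - gibbsExpect J lam g) ^ 2 * gibbsWeight J lam φ)
    (hsM : Summable fun k => (∫ φ, (g φ - gibbsExpect J lam g)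
        * (M^[k + 1] (fun ψ => g ψ - gibbsExpect J lam g)) φ * gibbsWeight J lam φ)
        / ∫ φ, (g φ - gibbsExpect J lam g) ^ 2 * gibbsWeight J lam φ) :
    tauInt (fun k => (∫ φ, (g φ - gibbsExpect J lam g)
          * (M^[k] (fun ψ => g ψ - gibbsExpect J lam g)) φ * gibbsWeight J lam φ)
          / ∫ φ, (g φ - gibbsExpect J lam g) ^ 2 * gibbsWeight J lam φ) + 1 / 2
      ≤ 1 / ∑ i, α i / (tauInt (fun k => (∫ φ, (g φ - gibbsExpect J lam g)
          * ((imhOpPhi4 J lam (q i))^[k] (fun ψ => g ψ - gibbsExpect J lam g)) φ * gibbsWeight J lam φ)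
          / ∫ φ, (g φ - gibbsExpect J lam g) ^ 2 * gibbsWeight J lam φ) + 1 / 2) := by
  have hco := latticePhi4Action_coercive hlam J
  have hpk := fun i => imhOpPhi4_revOp_bddObs hlam J (hq0 i) (hqm i) (hqi i) (hq1 i)
  have hgc := bddObs_sub_gibbsExpect J lam hg
  have h := RevOp.tauInt_mixN_add_half_le_harmonicMean (μ := volume) (A := BddObs)
    (K := fun i => imhOpPhi4 J lam (q i)) (M := M) (α := α) (w := gibbsWeight J lam)
    (fun φ => (gibbsWeight_pos J lam φ).le)
    (fun f h hf hh => bddObs_integrable_mul_mul_gibbsWeight one_pos hco hf hh)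
    (fun f h c hf hh => bddObs_add_mul hf hh c)
    (fun i => (hpk i).1) (fun i => (hpk i).2.1) (fun i => (hpk i).2.2.1) (fun i => (hpk i).2.2.2)
    hM hα hα1 hgc hP (S := Finset.univ) Finset.univ_nonempty (fun i _ => hs i) hsM
  simpa using h

end Lattice

end Summit.Ventures.LatticeQCDFlow.Exactness
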